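import Literature.Geometry.Kaehler.ComplexTorusQuaternionUnitGroupCompactSubgroups
import Literature.Geometry.Kaehler.ComplexTorusQuaternionUnitGroupCocompact
import Literature.Geometry.Kaehler.ComplexTorusQuaternionUnitGroupArithmetic
import Literature.NumberTheory.Automorphic.QuaternionAlgebraIntegralModel
import Literature.NumberTheory.Automorphic.JordanZassenhaus
import Literature.NumberTheory.Automorphic.FuchsianEichlerShimuraWeightTwo
import HarnessLib

/-!
# The norm-one group `ι(O¹)` of ANY order in an indefinite DIVISION quaternion algebra over `ℚ` is cocompact, and the
# real period map of weight-two forms on it is injective (Vignéras IV Thm. 1.1 ∕ Prop. 1.4; Shimura §9.2, Thm. 8.4)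

Topic `NumberTheory/Automorphic`; THEOREMS ONLY (no definition, no named fact, no instance, no `sorry`; D-0014 ∕ D-0026).
Filed by the BSD cell `bsd-stepL` (seat `defn-ty1` g45, literature-prover) to make the injectivity half of the named fact
(ESᶜ) `Literature.NumberTheory.Automorphic.eichlerShimura_weightTwo_rePeriod` (`FuchsianEichlerShimuraWeightTwo.lean`,
Shimura Thm. 8.4 at `n = 0`) a THEOREM whenever `B` is a division algebra — for EVERY order `O ⊆ B` and EVERY
`ℚ`-algebra map `ι : B → M₂(ℝ)` — so that what remains print of (ESᶜ) is exactly its surjectivity and the injectivity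
at `B ≅ M₂(ℚ)` (the cusp case).

## Contents (namespace `Literature.NumberTheory.Automorphic`)

* `exists_isCompact_forall_exists_mem_normOneUnits_smul_mem` — **`Γ = ι(O¹)` IS COCOMPACT for a division algebra**:
  there is a compact `K ⊆ ℍ` meeting every `Γ`-orbit («Γ'∖ℌ is compact unless B is isomorphic to M₂(Q)», Shimura §9.2
  p. 246; Vignéras IV Thm. 1.1 (3): `ℋ∕O¹` compact iff `H` is a field). PROOF (a transport from the Hodge lane
  `Literature/Geometry/Kaehler/ComplexTorusQuaternion*`, which treats the explicit family `Γ_{a,b} = ρ(𝔬¹) ≤ SL₂(ℝ)`,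
  `𝔬 = ℤ⟨1, i, j, ij⟩ ⊂ (a, b)_ℚ`, `a ≠ 0 < b`): (1) normal form `B ≅ (a, b)_ℚ` with `a, b ∈ ℤ`, `a ≠ 0 < b`
  (Vignéras' standard basis + clearing denominators + the swap `(a, b) ≅ (b, a)`; indefiniteness is READ OFF `ι`: for
  `a, b < 0` the norm form of `(a, b)_ℝ` is anisotropic and `ι ⊗ ℝ` would be an isomorphism onto `M₂(ℝ)`); (2) Skolem–
  Noether `ι = h ρ(·) h⁻¹`, `h ∈ GL₂(ℝ)`; (3) Jordan–Zassenhaus ∕ commensurability of lattices: `N𝔬 ⊆ O` for some `N ≥ 1`,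
  so every `ρ(ε)` with `ε ∈ 𝔬¹`, `ε ≡ 1 (mod N𝔬)` conjugates INTO `Γ` — i.e. `h Γ_{a,b}(N) h⁻¹ ≤ Γ` (Vignéras IV
  Prop. 1.4: the unit groups of the orders of `B` are pairwise commensurable); (4) `Γ_{a,b}` is cocompact when
  `(a, b)_ℚ` is a skew field (Hodge lane `exists_isCompact_forall_exists_smul_mem`, Bergeron Thm. 2.3 (3)), its
  finite-index subgroup `Γ_{a,b}(N)` inherits a compact set of representatives (Shimura Prop. 1.31, Hodge lane
  `exists_isCompact_reps_of_finiteIndex`), and `h • K` then meets every `Γ`-orbit.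
* `exists_conj_congruenceUnitGroup_mem_normOneUnits` — the TRANSPORT DATUM behind it, for ANY `(B, O, ι)` (no division hypothesis):
  `a ≠ 0 < b`, `f : B ≃ (a, b)_ℚ`, `h ∈ GL₂(ℝ)` with `ι = h ρ(f ·) h⁻¹`, and `N ≥ 1` with `h Γ_{a,b}(N) h⁻¹ ≤ ι(O¹)` elementwise
  (Vignéras IV Prop. 1.4, the half used here); public so that the cusp-case (`B ≅ M₂(ℚ)`) injectivity can reuse it.
* `CuspForm.eq_zero_of_forall_rePeriod_eq_zero_of_forall_isUnit` — **INJECTIVITY IN SHIMURA Thm. 8.4 (`n = 0`) for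
  `Γ = ι(O¹)`, `B` a division algebra**: a weight-two cusp form all of whose real periods `Re ∫_{z₀}^{γ z₀} F` vanish is
  zero (maximum modulus for `exp ∘ ∫F` on the cocompact quotient; Shimura Thm. 8.4, injectivity half).
* `eichlerShimura_weightTwo_rePeriod_injective_of_forall_isUnit` — the same packaged over all `(B, O, ι)` in the
  binder shape of the hypothesis `hdiv` of `eichlerShimura_weightTwo_rePeriod_of_residue` (`FuchsianEichlerShimuraWeightTwo.lean`).
* `eichlerShimura_weightTwo_rePeriod_of_residue'`, `eichlerShimura_weightTwo_rePeriod_iff_residue` — **(ESᶜ) ⟺ (ESᶜ-inj-split)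
  ∧ (ESᶜ-surj)**: the print residue of (ESᶜ) is exactly the injectivity at `B ≅ M₂(ℚ)` (cusps) and the surjectivity.

DEVIATIONS. (i) The normal-form and Skolem–Noether steps are re-proved here as `private` lemmas (they exist in the tree as
`QuaternionType.exists_units_forall_eq_conj` of `…ComplexTorusQuaternionUnitGroupCommensurable` and, Summit-side, in
`…CartanCarayolQuaternionNormalForm`; the former module is outside the checking farm's build closure, the latter cannot be
imported into `Literature/`). (ii) The maximum-modulus argument is the one of
`Literature/NumberTheory/Automorphic/ShimuraCurvePeriodsHeckeIntegralityProofs.lean` §3 (same build-closure reason), `private` here.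

What this file does NOT do: nothing at `B ≅ M₂(ℚ)` (cusps); no surjectivity (Hodge theory); no Hecke operators; BSD is
proved for no curve.

## References

* [VignerasLNM800] M.-F. Vignéras, *Arithmétique des algèbres de quaternions*, LNM 800 (1980): Ch. I §1 pp. 1–3 (standard
  basis, `(a, b) ≅ (b, a) ≅ (ac², bd²)`); Ch. IV §1 Thm. 1.1 p. 104 («ℋ∕O¹ est compact si et seulement si H est un corps»),
  Prop. 1.4 p. 105 («Les groupes O¹, pour O ∈ Ω, sont commensurables deux à deux»).
* [ShimuraIATAF1971] G. Shimura, *Introduction to the arithmetic theory of automorphic functions* (1971): §1.3 Prop. 1.31;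
  Thm. 8.4 p. 234; §9.2 p. 246.
* [Bergeron2016] N. Bergeron, *The Spectrum of Hyperbolic Surfaces* (2016), §2.2 Thm. 2.3 (3)–(4) pp. 36–37, §2.3.1 p. 44.
* [Voight2021] J. Voight, *Quaternion Algebras*, GTM 288, §7.7 Main Thm. 7.7.1, Cor. 7.7.4 (Skolem–Noether).
-/

noncomputable section

open scoped MatrixGroups

namespace Literature.NumberTheory.Automorphic

open Literature.Geometry.Kaehler.ComplexTorus
open Literature.Geometry.Kaehler.ComplexTorus.QuaternionType

/-! ### §1 Normal form `B ≅ (a, b)_ℚ`, `a, b ∈ ℤ`, `a ≠ 0 < b`, and Skolem–Noether `ι = h ρ(·) h⁻¹` (private ports) -/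

section NormalForm

open scoped Quaternion

/-- Swap of parameters `ℍ[K,a,b] ≅ ℍ[K,b,a]`. [cite: VignerasLNM800, Ch. I §1 p. 2] -/
private theorem nonempty_algEquiv_quaternionAlgebra_swap' {K : Type*} [Field K] [NeZero (2 : K)] {a b : K}
    (ha : a ≠ 0) (hb : b ≠ 0) : Nonempty (ℍ[K,a,b] ≃ₐ[K] ℍ[K,b,a]) := by
  let q : _root_.QuaternionAlgebra.Basis ℍ[K,b,a] a 0 b :=
    { i := ⟨0, 0, 1, 0⟩, j := ⟨0, 1, 0, 0⟩, k := ⟨0, 0, 0, -1⟩,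
      i_mul_i := by ext <;> simp
      j_mul_j := by ext <;> simp
      i_mul_j := by ext <;> simp
      j_mul_i := by ext <;> simp }
  haveI := QuaternionAlgebra.isSimpleRing ha hb
  have hinj : Function.Injective q.liftHom := RingHom.injective q.liftHom.toRingHom
  have hdim : Module.finrank K ℍ[K,a,b] = Module.finrank K ℍ[K,b,a] := by
    rw [QuaternionAlgebra.finrank_eq_four, QuaternionAlgebra.finrank_eq_four]
  exact ⟨AlgEquiv.ofBijective q.liftHom
    ⟨hinj, (LinearMap.injective_iff_surjective_of_finrank_eq_finrank hdim (f := q.liftHom.toLinearMap)).mp hinj⟩⟩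

/-- Integral parameters: a quaternion algebra over `ℚ` is `≅ (a, b)_ℚ` with `a, b ∈ ℤ ∖ {0}`. [cite: VignerasLNM800, Ch. I §1 p. 1–2] -/
private theorem exists_int_nonempty_algEquiv_quaternionAlgebra' (B : Type*) [Ring B] [Algebra ℚ B]
    [IsQuaternionAlgebra ℚ B] : ∃ a b : ℤ, a ≠ 0 ∧ b ≠ 0 ∧ Nonempty (B ≃ₐ[ℚ] ℍ[ℚ,(a : ℚ),(b : ℚ)]) := by
  obtain ⟨a₀, b₀, ha₀, hb₀, ⟨e₀⟩⟩ := IsQuaternionAlgebra.exists_algEquiv_quaternionAlgebra ℚ B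
  have hda : (a₀.den : ℚ) ≠ 0 := Nat.cast_ne_zero.mpr a₀.den_ne_zero
  have hdb : (b₀.den : ℚ) ≠ 0 := Nat.cast_ne_zero.mpr b₀.den_ne_zero
  have h₁ : ((a₀.num * a₀.den : ℤ) : ℚ) = a₀ * (a₀.den : ℚ) ^ 2 := by
    push_cast
    rw [sq, ← mul_assoc, Rat.mul_den_eq_num]
  have h₂ : ((b₀.num * b₀.den : ℤ) : ℚ) = b₀ * (b₀.den : ℚ) ^ 2 := by
    push_cast
    rw [sq, ← mul_assoc, Rat.mul_den_eq_num]
  obtain ⟨e₁⟩ := QuaternionAlgebra.nonempty_algEquiv_of_eq_mul_sq ha₀ hb₀ hda hdb h₁ h₂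
  exact ⟨a₀.num * a₀.den, b₀.num * b₀.den,
    mul_ne_zero (Rat.num_ne_zero.mpr ha₀) (Int.natCast_ne_zero.mpr a₀.den_ne_zero),
    mul_ne_zero (Rat.num_ne_zero.mpr hb₀) (Int.natCast_ne_zero.mpr b₀.den_ne_zero), ⟨e₀.trans e₁⟩⟩

/-- A rational scalar of the `ℚ`-algebra `M₂(ℝ)` is the real scalar matrix. [folklore] -/
private theorem algebraMap_rat_matrix' (q : ℚ) :
    algebraMap ℚ (Matrix (Fin 2) (Fin 2) ℝ) q = algebraMap ℝ (Matrix (Fin 2) (Fin 2) ℝ) (q : ℝ) := by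
  rw [Algebra.algebraMap_eq_smul_one, Algebra.algebraMap_eq_smul_one, Rat.cast_smul_eq_qsmul]

/-- A quaternion in the basis `1, i, j, ij`. [folklore] -/
private theorem eq_basis_sum'' {R : Type*} [CommRing R] {a b : ℤ} (x : ℍ[R,(a : R),(b : R)]) :
    x = algebraMap R _ x.re + x.imI • (⟨0, 1, 0, 0⟩ : ℍ[R,(a : R),(b : R)]) +
      x.imJ • (⟨0, 0, 1, 0⟩ : ℍ[R,(a : R),(b : R)]) +
      x.imK • ((⟨0, 1, 0, 0⟩ : ℍ[R,(a : R),(b : R)]) * ⟨0, 0, 1, 0⟩) := by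
  ext <;> simp

/-- Base change of a rational representation `g : (a, b)_ℚ →ₐ[ℚ] M₂(ℝ)` to `(a, b)_ℝ →ₐ[ℝ] M₂(ℝ)`. [cite: Bergeron2016, §2.2 proof of Thm. 2.3 p. 37] -/
private theorem exists_algHom_extension_real'' {a b : ℤ} (g : ℍ[ℚ,(a : ℚ),(b : ℚ)] →ₐ[ℚ] Matrix (Fin 2) (Fin 2) ℝ) :
    ∃ ψ : ℍ[ℝ,(a : ℝ),(b : ℝ)] →ₐ[ℝ] Matrix (Fin 2) (Fin 2) ℝ, ∀ x, ψ (castQ a b x) = g x := by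
  set I : ℍ[ℚ,(a : ℚ),(b : ℚ)] := ⟨0, 1, 0, 0⟩ with hI
  set J : ℍ[ℚ,(a : ℚ),(b : ℚ)] := ⟨0, 0, 1, 0⟩ with hJ
  have hII : I * I = algebraMap ℚ _ (a : ℚ) := by
    rw [hI]; ext <;> simp
  have hJJ : J * J = algebraMap ℚ _ (b : ℚ) := by
    rw [hJ]; ext <;> simp
  have hJI : J * I = -(I * J) := by
    rw [hI, hJ]; ext <;> simp
  have hEi : g I * g I = ((a : ℤ) : ℝ) • (1 : Matrix (Fin 2) (Fin 2) ℝ) + (0 : ℝ) • g I := by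
    rw [zero_smul, add_zero, ← map_mul, hII, AlgHom.commutes, algebraMap_rat_matrix', Algebra.algebraMap_eq_smul_one,
      Rat.cast_intCast]
  have hEj : g J * g J = ((b : ℤ) : ℝ) • (1 : Matrix (Fin 2) (Fin 2) ℝ) := by
    rw [← map_mul, hJJ, AlgHom.commutes, algebraMap_rat_matrix', Algebra.algebraMap_eq_smul_one, Rat.cast_intCast]
  have hEji : g J * g I = (0 : ℝ) • g J - g I * g J := by
    rw [zero_smul, zero_sub, ← map_mul, ← map_mul, hJI, map_neg]
  let q : _root_.QuaternionAlgebra.Basis (Matrix (Fin 2) (Fin 2) ℝ) ((a : ℤ) : ℝ) 0 ((b : ℤ) : ℝ) :=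
    { i := g I, j := g J, k := g I * g J,
      i_mul_i := hEi, j_mul_j := hEj, i_mul_j := rfl, j_mul_i := hEji }
  refine ⟨q.liftHom, fun x ↦ ?_⟩
  rw [QuaternionAlgebra.Basis.liftHom_apply, QuaternionAlgebra.Basis.lift]
  conv_rhs => rw [eq_basis_sum'' x]
  simp only [map_add, map_mul, AlgHom.commutes, map_smul, castQ_re, castQ_imI, castQ_imJ, castQ_imK]
  rw [algebraMap_rat_matrix', ← Rat.cast_smul_eq_qsmul ℝ x.imI, ← Rat.cast_smul_eq_qsmul ℝ x.imJ,
    ← Rat.cast_smul_eq_qsmul ℝ x.imK]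

/-- Skolem–Noether for a rational representation into `M₂(ℝ)` (`a ≠ 0 < b`): `g(x) = h ρ(x) h⁻¹` for some `h ∈ GL₂(ℝ)`.
[cite: Voight2021, §7.7 Main Thm. 7.7.1 and Cor. 7.7.4] [cite: Bergeron2016, §2.2 proof of Thm. 2.3 p. 37] -/
private theorem exists_units_forall_eq_conj'' {a b : ℤ} (ha : a ≠ 0) (hb : 0 < b)
    (g : ℍ[ℚ,(a : ℚ),(b : ℚ)] →ₐ[ℚ] Matrix (Fin 2) (Fin 2) ℝ) :
    ∃ h : GL (Fin 2) ℝ, ∀ x : ℍ[ℚ,(a : ℚ),(b : ℚ)],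
      g x = (h : Matrix (Fin 2) (Fin 2) ℝ) * rho a b hb.le (castQ a b x) * ((h⁻¹ : GL (Fin 2) ℝ) : Matrix (Fin 2) (Fin 2) ℝ) := by
  obtain ⟨ψ, hψ⟩ := exists_algHom_extension_real'' (a := a) (b := b) g
  obtain ⟨ρ', hρ'⟩ := exists_algEquiv_eq_rho ha hb
  obtain ⟨u, hu⟩ := Literature.RingTheory.CentralSimple.Matrix.exists_units_forall_algHom_eq_conj (K := ℝ)
    (ψ.comp (ρ'.symm : Matrix (Fin 2) (Fin 2) ℝ →ₐ[ℝ] ℍ[ℝ,(a : ℝ),(b : ℝ)]))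
  refine ⟨u, fun x ↦ ?_⟩
  have h1 : ψ (castQ a b x) = (ψ.comp (ρ'.symm : Matrix (Fin 2) (Fin 2) ℝ →ₐ[ℝ] ℍ[ℝ,(a : ℝ),(b : ℝ)]))
      (rho a b hb.le (castQ a b x)) := by
    rw [AlgHom.comp_apply]
    change ψ (castQ a b x) = ψ (ρ'.symm (rho a b hb.le (castQ a b x)))
    rw [← hρ', AlgEquiv.symm_apply_apply]
  rw [← hψ, h1, hu]

/-- An algebra `(a, b)_ℚ` (`a, b ∈ ℤ ∖ {0}`) with a `ℚ`-algebra map to `M₂(ℝ)` is indefinite: `0 < a` or `0 < b`.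
[cite: VignerasLNM800, Ch. I §1; Ch. IV §1] -/
private theorem pos_or_pos_of_algHom_matrix_real' {a b : ℤ} (ha : a ≠ 0) (hb : b ≠ 0)
    (g : ℍ[ℚ,(a : ℚ),(b : ℚ)] →ₐ[ℚ] Matrix (Fin 2) (Fin 2) ℝ) : 0 < a ∨ 0 < b := by
  by_contra hneg
  push Not at hneg
  have ha' : (a : ℝ) < 0 := by exact_mod_cast lt_of_le_of_ne hneg.1 ha
  have hb' : (b : ℝ) < 0 := by exact_mod_cast lt_of_le_of_ne hneg.2 hb
  obtain ⟨ψ, -⟩ := exists_algHom_extension_real'' g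
  have hN : ∀ x : ℍ[ℝ,(a : ℝ),(b : ℝ)], x * star x =
      algebraMap ℝ _ (x.re ^ 2 - (a : ℝ) * x.imI ^ 2 - (b : ℝ) * x.imJ ^ 2 + (a : ℝ) * (b : ℝ) * x.imK ^ 2) := by
    intro x
    rw [QuaternionAlgebra.algebraMap_eq]
    ext <;> simp <;> ring
  have hpos : ∀ x : ℍ[ℝ,(a : ℝ),(b : ℝ)], x ≠ 0 →
      0 < x.re ^ 2 - (a : ℝ) * x.imI ^ 2 - (b : ℝ) * x.imJ ^ 2 + (a : ℝ) * (b : ℝ) * x.imK ^ 2 := by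
    intro x hx
    have hab : 0 < (a : ℝ) * (b : ℝ) := mul_pos_of_neg_of_neg ha' hb'
    have h0 : 0 ≤ x.re ^ 2 := sq_nonneg _
    have h1 : 0 ≤ -(a : ℝ) * x.imI ^ 2 := mul_nonneg (neg_nonneg.mpr ha'.le) (sq_nonneg _)
    have h2 : 0 ≤ -(b : ℝ) * x.imJ ^ 2 := mul_nonneg (neg_nonneg.mpr hb'.le) (sq_nonneg _)
    have h3 : 0 ≤ (a : ℝ) * (b : ℝ) * x.imK ^ 2 := mul_nonneg hab.le (sq_nonneg _)
    rcases (show x.re ≠ 0 ∨ x.imI ≠ 0 ∨ x.imJ ≠ 0 ∨ x.imK ≠ 0 by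
      by_contra h
      push Not at h
      exact hx (QuaternionAlgebra.ext h.1 h.2.1 h.2.2.1 h.2.2.2)) with h | h | h | h
    · have : 0 < x.re ^ 2 := by positivity
      nlinarith
    · have : 0 < -(a : ℝ) * x.imI ^ 2 := mul_pos (neg_pos.mpr ha') (by positivity)
      nlinarith
    · have : 0 < -(b : ℝ) * x.imJ ^ 2 := mul_pos (neg_pos.mpr hb') (by positivity)
      nlinarith
    · have : 0 < (a : ℝ) * (b : ℝ) * x.imK ^ 2 := mul_pos hab (by positivity)
      nlinarith
  have hinj : Function.Injective ψ := by
    rw [injective_iff_map_eq_zero]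
    intro x hx
    by_contra hx0
    have h1 : ψ (x * star x) = 0 := by rw [map_mul, hx, zero_mul]
    rw [hN, AlgHom.commutes, Algebra.algebraMap_eq_smul_one, smul_eq_zero] at h1
    rcases h1 with h1 | h1
    · exact (hpos x hx0).ne' h1
    · exact one_ne_zero h1
  have hdim : Module.finrank ℝ ℍ[ℝ,(a : ℝ),(b : ℝ)] = Module.finrank ℝ (Matrix (Fin 2) (Fin 2) ℝ) := by
    rw [QuaternionAlgebra.finrank_eq_four, Module.finrank_matrix]
    simp
  have hsurj : Function.Surjective ψ :=
    (LinearMap.injective_iff_surjective_of_finrank_eq_finrank hdim (f := ψ.toLinearMap)).mp hinj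
  obtain ⟨x, hx⟩ := hsurj (Matrix.of ![![1, 0], ![0, 0]])
  have hx0 : x ≠ 0 := by
    rintro rfl
    have := congr_fun (congr_fun hx 0) 0
    simp at this
  have h2 : ψ (x * star x) = Matrix.of ![![1, 0], ![0, 0]] * ψ (star x) := by rw [map_mul, hx]
  rw [hN, AlgHom.commutes, Algebra.algebraMap_eq_smul_one] at h2
  have h3 := congr_fun (congr_fun h2 1) 1
  simp [Matrix.mul_apply, Fin.sum_univ_two] at h3
  exact (hpos x hx0).ne' h3

/-- Normal form of a quaternion algebra over `ℚ` mapping to `M₂(ℝ)`: `B ≅ (a, b)_ℚ`, `a, b ∈ ℤ`, `a ≠ 0 < b`.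
[cite: VignerasLNM800, Ch. I §1, Ch. IV §1] [cite: Bergeron2016, §2.2 Thm. 2.3 p. 36] -/
private theorem exists_int_pos_nonempty_algEquiv_quaternionAlgebra' (B : Type*) [Ring B] [Algebra ℚ B]
    [IsQuaternionAlgebra ℚ B] (ι : B →ₐ[ℚ] Matrix (Fin 2) (Fin 2) ℝ) :
    ∃ a b : ℤ, a ≠ 0 ∧ 0 < b ∧ Nonempty (B ≃ₐ[ℚ] ℍ[ℚ,(a : ℚ),(b : ℚ)]) := by
  obtain ⟨a, b, ha, hb, ⟨f⟩⟩ := exists_int_nonempty_algEquiv_quaternionAlgebra' B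
  rcases pos_or_pos_of_algHom_matrix_real' ha hb (ι.comp (f.symm : ℍ[ℚ,(a : ℚ),(b : ℚ)] →ₐ[ℚ] B)) with ha' | hb'
  · obtain ⟨s⟩ := nonempty_algEquiv_quaternionAlgebra_swap' (K := ℚ) (a := (a : ℚ)) (b := (b : ℚ))
      (Int.cast_ne_zero.mpr ha) (Int.cast_ne_zero.mpr hb)
    exact ⟨b, a, hb, ha', ⟨f.trans s⟩⟩
  · exact ⟨a, b, ha, hb', ⟨f⟩⟩

end NormalForm

/-! ### §2 `Γ = ι(O¹)` is cocompact when `B` is a division algebra -/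

section Cocompact

open scoped Quaternion Pointwise

variable {B : Type*} [Ring B] [Algebra ℚ B]

/-- Matrix inverses inside `ι(O)`: if `x y ∈ O` with `xy = 1` and `ι(x) = g`, `det g = 1`, then `g ∈ ι(O¹)`. [folklore] -/
private theorem mem_normOneUnits_of_mul_eq_one' (ι : B →ₐ[ℚ] Matrix (Fin 2) (Fin 2) ℝ)
    {O : Submodule ℤ B} (hO : Brandt.IsOrder B O) {x y : B} (hx : x ∈ O) (hy : y ∈ O) (hxy : x * y = 1)
    {g : GL (Fin 2) ℝ} (hg : ι x = (g : Matrix (Fin 2) (Fin 2) ℝ)) (hdet : Matrix.GeneralLinearGroup.det g = 1) :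
    g ∈ normOneUnits ι hO := by
  refine ⟨⟨x, hx, hg⟩, ⟨y, hy, ?_⟩, hdet⟩
  have h1 : (g : Matrix (Fin 2) (Fin 2) ℝ) * ι y = 1 := by rw [← hg, ← map_mul, hxy, map_one]
  rw [Matrix.coe_units_inv, Matrix.inv_eq_right_inv h1]

/-- **TRANSPORT DATUM `(B, O, ι) ↦ (a, b, f, h, N)`: a conjugate principal congruence subgroup of the Hodge lane's `Γ_{a,b}` sits
inside `ι(O¹)`.** For every quaternion algebra `B` over `ℚ`, order `O` and `ℚ`-algebra map `ι : B → M₂(ℝ)` there are integers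
`a ≠ 0 < b`, an isomorphism `f : B ≃ₐ[ℚ] (a, b)_ℚ`, a matrix `h ∈ GL₂(ℝ)` and a level `N ≥ 1` with `ι = h ρ(f ·) h⁻¹` (Skolem–Noether)
and `h ρ(ε) h⁻¹ ∈ ι(O¹)` for every `ε ∈ 𝔬¹` with `ε ≡ 1 (mod N𝔬)`, i.e. `h Γ_{a,b}(N) h⁻¹ ≤ ι(O¹)` elementwise (Jordan–Zassenhaus:
`N𝔬 ⊆ f(O)`). This is Vignéras IV Prop. 1.4 («Les groupes O¹, pour O ∈ Ω, sont commensurables deux à deux») in the half that the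
cocompactness and injectivity transports need; no division hypothesis. [cite: VignerasLNM800, Ch. I §1 and Ch. IV §1 Prop. 1.4 p. 105] [cite: Voight2021, §7.7 Cor. 7.7.4] [cite: Bergeron2016, §2.2 Thm. 2.3 (4) p. 36 and §2.3.1 p. 44] -/
theorem exists_conj_congruenceUnitGroup_mem_normOneUnits (B : Type*) [Ring B] [Algebra ℚ B] [IsQuaternionAlgebra ℚ B]
    (O : Submodule ℤ B) (hO : Brandt.IsOrder B O) (ι : B →ₐ[ℚ] Matrix (Fin 2) (Fin 2) ℝ) :
    ∃ (a b : ℤ) (hb : 0 < b) (f : B ≃ₐ[ℚ] ℍ[ℚ,(a : ℚ),(b : ℚ)]) (h : GL (Fin 2) ℝ) (N : ℕ), a ≠ 0 ∧ N ≠ 0 ∧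
      (∀ x : B, ι x = (h : Matrix (Fin 2) (Fin 2) ℝ) * rho a b hb.le (castQ a b (f x)) *
        ((h⁻¹ : GL (Fin 2) ℝ) : Matrix (Fin 2) (Fin 2) ℝ)) ∧
      ∀ g ∈ congruenceUnitGroup a b hb.le N, h * Matrix.SpecialLinearGroup.toGL g * h⁻¹ ∈ normOneUnits ι hO := by
  classical
  obtain ⟨a, b, ha, hb, ⟨f⟩⟩ := exists_int_pos_nonempty_algEquiv_quaternionAlgebra' B ι
  -- Skolem–Noether: `ι ∘ f⁻¹ = h ρ(·) h⁻¹`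
  obtain ⟨h, hh⟩ := exists_units_forall_eq_conj'' ha hb (ι.comp (f.symm : ℍ[ℚ,(a : ℚ),(b : ℚ)] →ₐ[ℚ] B))
  have hhs : ∀ y : ℍ[ℚ,(a : ℚ),(b : ℚ)], ι (f.symm y) =
      (h : Matrix (Fin 2) (Fin 2) ℝ) * rho a b hb.le (castQ a b y) * ((h⁻¹ : GL (Fin 2) ℝ) : Matrix (Fin 2) (Fin 2) ℝ) :=
    fun y => by simpa only [AlgHom.comp_apply, AlgEquiv.coe_toAlgHom] using hh y
  have hconj : ∀ x : B, ι x =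
      (h : Matrix (Fin 2) (Fin 2) ℝ) * rho a b hb.le (castQ a b (f x)) * ((h⁻¹ : GL (Fin 2) ℝ) : Matrix (Fin 2) (Fin 2) ℝ) :=
    fun x => by simpa only [AlgEquiv.symm_apply_apply] using hhs (f x)
  -- (1) `N·𝔬 ⊆ f(O)` (Jordan–Zassenhaus)
  let gZ : ℍ[ℚ,(a : ℚ),(b : ℚ)] →ₗ[ℤ] B := (f.symm : ℍ[ℚ,(a : ℚ),(b : ℚ)] →+* B).toAddMonoidHom.toIntLinearMap
  obtain ⟨n, hn0, hn⟩ := exists_smul_mem_of_fg hO.isFullLattice ((isOrder_orderSubmodule a b).isFullLattice.1.map gZ)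
  set N : ℕ := n.natAbs with hNdef
  have hN0 : N ≠ 0 := Int.natAbs_ne_zero.mpr hn0
  have hNmem : ∀ ξ ∈ order a b, N • f.symm ξ ∈ O := by
    intro ξ hξ
    have hx : f.symm ξ ∈ (orderSubmodule a b).map gZ := Submodule.mem_map_of_mem (f := gZ) hξ
    have h1 := hn _ hx
    rw [← natCast_zsmul]
    rcases Int.natAbs_eq n with h' | h'
    · rwa [hNdef, ← h']
    · have h2 : (N : ℤ) = -n := by rw [hNdef]; omega
      rw [h2, neg_smul]
      exact O.neg_mem h1
  refine ⟨a, b, hb, f, h, N, ha, hN0, hconj, fun g hg => ?_⟩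
  -- (2) membership in `ι(O¹)`: `ε = 1 + N ξ' ∈ f(O)`, `ε ε̄ = 1`
  obtain ⟨ε, -, hε1, ⟨ξ', hξ', hεξ'⟩, hgε⟩ := hg
  have hxO : f.symm ε ∈ O := by
    rw [hεξ', map_add, map_one, map_nsmul]
    exact O.add_mem hO.one_mem (hNmem ξ' hξ')
  have hyO : f.symm (star ε) ∈ O := by
    rw [hεξ', star_add, star_one, star_nsmul, map_add, map_one, map_nsmul]
    exact O.add_mem hO.one_mem (hNmem _ (star_mem_order hξ'))
  refine mem_normOneUnits_of_mul_eq_one' ι hO hxO hyO ?_ ?_ ?_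
  · rw [← map_mul, hε1, map_one]
  · rw [hhs, ← hgε, Units.val_mul, Units.val_mul, Matrix.SpecialLinearGroup.coe_GL_coe_matrix]
  · rw [map_mul, map_mul, map_inv, mul_inv_cancel_comm]
    ext
    rw [Matrix.GeneralLinearGroup.val_det_apply, Matrix.SpecialLinearGroup.coe_GL_coe_matrix, g.prop, Units.val_one]

/-- **`Γ = ι(O¹)` IS COCOMPACT FOR A DIVISION ALGEBRA.** For a quaternion algebra `B` over `ℚ` in which every non-zero
element is a unit, ANY order `O ⊆ B` and ANY `ℚ`-algebra map `ι : B → M₂(ℝ)`, some compact `K ⊆ ℍ` meets every orbit of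
`normOneUnits ι hO = ι(O¹)` («Γ'∖ℌ is compact unless B is isomorphic to M₂(Q)»; «ℋ∕O¹ est compact si et seulement si H
est un corps»). Transport from the Hodge lane's family `Γ_{a,b} = ρ(𝔬¹)`: normal form `B ≅ (a, b)_ℚ` (`a ≠ 0 < b`),
Skolem–Noether `ι = h ρ(·) h⁻¹`, `N𝔬 ⊆ O` (Jordan–Zassenhaus) so that `h Γ_{a,b}(N) h⁻¹ ≤ ι(O¹)` (Vignéras IV Prop. 1.4),
cocompactness of `Γ_{a,b}` (Bergeron Thm. 2.3 (3)) inherited by the finite-index `Γ_{a,b}(N)` (Shimura Prop. 1.31).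
[cite: ShimuraIATAF1971, §9.2 p. 246 and §1.3 Prop. 1.31] [cite: VignerasLNM800, Ch. IV §1 Thm. 1.1 p. 104 and Prop. 1.4 p. 105] [cite: Bergeron2016, §2.2 Thm. 2.3 (3) p. 36] -/
theorem exists_isCompact_forall_exists_mem_normOneUnits_smul_mem (B : Type*) [Ring B] [Algebra ℚ B]
    [IsQuaternionAlgebra ℚ B] (O : Submodule ℤ B) (hO : Brandt.IsOrder B O) (ι : B →ₐ[ℚ] Matrix (Fin 2) (Fin 2) ℝ)
    (hdiv : ∀ x : B, x ≠ 0 → IsUnit x) :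
    ∃ K : Set UpperHalfPlane, IsCompact K ∧ ∀ z : UpperHalfPlane, ∃ γ ∈ normOneUnits ι hO, γ • z ∈ K := by
  classical
  obtain ⟨a, b, hb, f, h, N, ha, hN0, -, hmem⟩ := exists_conj_congruenceUnitGroup_mem_normOneUnits B O hO ι
  -- `(a, b)_ℚ` is a skew field, too
  have hQ : ∀ x : ℍ[ℚ,(a : ℚ),(b : ℚ)], x ≠ 0 → IsUnit x := by
    intro x hx
    have hx' : f.symm x ≠ 0 := fun h0 => hx (by simpa using congrArg f h0)
    simpa using (hdiv (f.symm x) hx').map f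
  -- compact representatives for `Γ_{a,b}(N)`
  obtain ⟨K₀, hK₀, hrep₀⟩ := exists_isCompact_forall_exists_smul_mem ha hb hQ
  haveI := finiteIndex_congruenceUnitGroup_subgroupOf ha hb hN0
  obtain ⟨K₁, hK₁, hrep₁⟩ := exists_isCompact_reps_of_finiteIndex
    (Γ' := congruenceUnitGroup a b hb.le N) (Γ := unitGroup a b hb.le) hK₀ hrep₀
  -- `h • K₁` meets every `ι(O¹)`-orbit
  refine ⟨h • K₁, hK₁.smul h, fun z => ?_⟩
  obtain ⟨g, hg, hgz⟩ := hrep₁ (h⁻¹ • z)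
  refine ⟨h * Matrix.SpecialLinearGroup.toGL g * h⁻¹, hmem g hg, ?_⟩
  rw [mul_smul, mul_smul, toGL_smul]
  exact Set.smul_mem_smul_set hgz

end Cocompact

/-! ### §3 Injectivity of the real period map on a cocompact `Γ` (maximum modulus; private port) and for `ι(O¹)`,
`B` a division algebra -/

section Injectivity

open UpperHalfPlane hiding I

variable {Γ : Subgroup (GL (Fin 2) ℝ)} [Γ.HasDetOne]

/-- `Ψ(γτ) = Ψ(τ) + ∫_{τ₀}^{γτ₀} F` for the primitive `Ψ = ∫_{τ₀}^τ F` and `γ ∈ Γ`.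
-- adapted from Literature/NumberTheory/Automorphic/ShimuraCurvePeriodsHeckeIntegralityProofs.lean §2 (module outside this file's build closure)
[cite: ShimuraIATAF1971, §8.2 (8.2.19)–(8.2.20)] -/
private theorem segmentIntegral_smul_eq_add_period'' (F : CuspForm Γ 2) {γ : GL (Fin 2) ℝ} (hγ : γ ∈ Γ) (τ₀ τ : ℍ) :
    segmentIntegral F τ₀ (γ • τ) = segmentIntegral F τ₀ τ + segmentIntegral F τ₀ (γ • τ₀) := by
  have hdet : 0 < γ.det.val := by
    rw [Subgroup.HasDetOne.det_eq hγ, Units.val_one]; exact one_pos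
  have hinv : segmentIntegral F (γ • τ₀) (γ • τ) = segmentIntegral F τ₀ τ := by
    rw [← segmentIntegral_slash_eq F hdet τ₀ τ, SlashInvariantForm.slash_action_eqn F γ hγ]
  have e2 := segmentIntegral_sub_segmentIntegral F τ₀ (γ • τ₀) (γ • τ)
  linear_combination e2 + hinv

/-- A weight-two form with purely imaginary periods on a cocompact group vanishes (Shimura Thm. 8.4, injectivity half;
maximum modulus for `exp ∘ ∫F`).
-- adapted from Literature/NumberTheory/Automorphic/ShimuraCurvePeriodsHeckeIntegralityProofs.lean §3 (module outside this file's build closure)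
[cite: ShimuraIATAF1971, Thm. 8.4 p. 234] -/
private theorem coe_eq_zero_of_forall_re_period_eq_zero'' {K : Set ℍ} (hK : IsCompact K)
    (hcov : ∀ τ : ℍ, ∃ γ ∈ Γ, γ • τ ∈ K) (F : CuspForm Γ 2) (τ₀ : ℍ)
    (H : ∀ γ ∈ Γ, (segmentIntegral F τ₀ (γ • τ₀)).re = 0) : (⇑F : ℍ → ℂ) = 0 := by
  set Ψ : ℍ → ℂ := segmentIntegral F τ₀ with hΨdef
  have hinv : ∀ γ ∈ Γ, ∀ τ : ℍ, (Ψ (γ • τ)).re = (Ψ τ).re := by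
    intro γ hγ τ
    rw [hΨdef, segmentIntegral_smul_eq_add_period'' F hγ τ₀ τ, Complex.add_re, H γ hγ, add_zero]
  have hderiv : ∀ z : ℂ, 0 < z.im → HasDerivAt (Ψ ∘ ofComplex) (F (ofComplex z)) z :=
    fun z hz => hasDerivAt_segmentIntegral F τ₀ hz
  have hdiff : DifferentiableOn ℂ (Ψ ∘ ofComplex) {z : ℂ | 0 < z.im} :=
    differentiableOn_segmentIntegral F τ₀
  have hΨc : Continuous Ψ := by
    have h2 : Ψ = (Ψ ∘ ofComplex) ∘ ((↑) : ℍ → ℂ) := by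
      funext τ; simp [ofComplex_apply]
    rw [h2]
    exact hdiff.continuousOn.comp_continuous continuous_coe fun τ => τ.im_pos
  have hKne : K.Nonempty := by
    obtain ⟨γ, -, hγ⟩ := hcov UpperHalfPlane.I
    exact ⟨_, hγ⟩
  obtain ⟨k, hkK, hk⟩ := hK.exists_isMaxOn hKne (Complex.continuous_re.comp hΨc).continuousOn
  have hmax : ∀ τ : ℍ, (Ψ τ).re ≤ (Ψ k).re := by
    intro τ
    obtain ⟨γ, hγ, hγτ⟩ := hcov τ
    rw [← hinv γ hγ τ]
    exact hk hγτ
  set f : ℂ → ℂ := fun z => Complex.exp ((Ψ ∘ ofComplex) z) with hfdef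
  have hfd : DifferentiableOn ℂ f {z : ℂ | 0 < z.im} := hdiff.cexp
  have hkU : (k : ℂ) ∈ {z : ℂ | 0 < z.im} := k.im_pos
  have hfmax : IsMaxOn (norm ∘ f) {z : ℂ | 0 < z.im} (k : ℂ) := by
    intro z hz
    simp only [Function.comp_apply, hfdef, Complex.norm_exp, Set.mem_setOf_eq]
    refine Real.exp_le_exp.mpr ?_
    rw [ofComplex_apply, ofComplex_apply_of_im_pos hz]
    exact hmax _
  have hconst := Complex.eqOn_of_isPreconnected_of_isMaxOn_norm
    (convex_halfSpace_im_gt 0).isPreconnected isOpen_upperHalfPlaneSet hfd hkU hfmax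
  funext τ
  have hτ : 0 < (τ : ℂ).im := τ.im_pos
  have hd1 : HasDerivAt f (Complex.exp ((Ψ ∘ ofComplex) (τ : ℂ)) * F (ofComplex (τ : ℂ))) (τ : ℂ) :=
    (hderiv (τ : ℂ) hτ).cexp
  have hd2 : HasDerivAt f 0 (τ : ℂ) := by
    have hev : f =ᶠ[nhds (τ : ℂ)] fun _ => f (k : ℂ) :=
      Filter.eventuallyEq_of_mem (isOpen_upperHalfPlaneSet.mem_nhds hτ) hconst
    exact (hasDerivAt_const (τ : ℂ) (f (k : ℂ))).congr_of_eventuallyEq hev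
  have h0 := hd1.unique hd2
  rw [ofComplex_apply] at h0
  rcases mul_eq_zero.mp h0 with h1 | h1
  · exact absurd h1 (Complex.exp_ne_zero _)
  · simpa using h1

/-- **INJECTIVITY IN SHIMURA Thm. 8.4 (`n = 0`, `Ψ = 1`) FOR `Γ = ι(O¹)`, `B` A DIVISION ALGEBRA** — every order `O`, every
`ι : B →ₐ[ℚ] M₂(ℝ)`, every base point: if all real periods `Re ∫_{z₀}^{γ z₀} F` (`CuspForm.rePeriod F z₀`) of a weight-two cusp
form `F` on `ι(O¹)` vanish, then `F = 0` (the quotient is compact, §2; maximum modulus). This is the first conjunct of the named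
fact `eichlerShimura_weightTwo_rePeriod` at every division `(B, O, ι)`, PROVED.
[cite: ShimuraIATAF1971, Thm. 8.4 p. 234 and §9.2 p. 246] [cite: VignerasLNM800, Ch. IV §1 Thm. 1.1 p. 104] -/
theorem CuspForm.eq_zero_of_forall_rePeriod_eq_zero_of_forall_isUnit (B : Type*) [Ring B] [Algebra ℚ B]
    [IsQuaternionAlgebra ℚ B] (O : Submodule ℤ B) (hO : Brandt.IsOrder B O) (ι : B →ₐ[ℚ] Matrix (Fin 2) (Fin 2) ℝ)
    (hdiv : ∀ x : B, x ≠ 0 → IsUnit x) (z₀ : ℍ) (F : CuspForm (normOneUnits ι hO) 2)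
    (hF : ∀ γ : normOneUnits ι hO, CuspForm.rePeriod F z₀ γ = 0) : F = 0 := by
  obtain ⟨K, hK, hcov⟩ := exists_isCompact_forall_exists_mem_normOneUnits_smul_mem B O hO ι hdiv
  have h0 := coe_eq_zero_of_forall_re_period_eq_zero'' hK hcov F z₀ fun γ hγ => hF ⟨γ, hγ⟩
  exact DFunLike.coe_injective (h0.trans CuspForm.coe_zero.symm)

/-- **The division-algebra injectivity, packaged over all `(B, O, ι)`** — exactly the hypothesis `hdiv` of
`eichlerShimura_weightTwo_rePeriod_of_residue` (`FuchsianEichlerShimuraWeightTwo.lean`), so that (ESᶜ) follows from its two named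
residues alone. [cite: ShimuraIATAF1971, Thm. 8.4 p. 234 and §9.2 p. 246] -/
theorem eichlerShimura_weightTwo_rePeriod_injective_of_forall_isUnit :
    ∀ (B : Type) [Ring B] [Algebra ℚ B] [IsQuaternionAlgebra ℚ B] (O : Submodule ℤ B) (hO : Brandt.IsOrder B O)
      (ι : B →ₐ[ℚ] Matrix (Fin 2) (Fin 2) ℝ), Function.Injective ι → (∀ x : B, x ≠ 0 → IsUnit x) →
      ∀ z₀ : ℍ, ∀ F : CuspForm (normOneUnits ι hO) 2,
        (∀ γ : normOneUnits ι hO, CuspForm.rePeriod F z₀ γ = 0) → F = 0 :=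
  fun B _ _ _ O hO ι _ hdiv z₀ F hF => CuspForm.eq_zero_of_forall_rePeriod_eq_zero_of_forall_isUnit B O hO ι hdiv z₀ F hF

end Injectivity

/-! ### §4 (ESᶜ) from its two named print residues alone -/

section Residue

/-- **(ESᶜ) FROM ITS TWO NAMED RESIDUES ALONE.** The named fact `eichlerShimura_weightTwo_rePeriod` (Shimura Thm. 8.4 at
`n = 0`, `Ψ = 1`, for every `Γ = ι(O¹)`) follows from (ESᶜ-inj-split) `eichlerShimura_weightTwo_rePeriod_injective_of_exists_not_isUnit`
(injectivity when `B` has a non-zero non-unit, i.e. `B ≅ M₂(ℚ)`: the cusp case) and (ESᶜ-surj) `eichlerShimura_weightTwo_rePeriod_surjective`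
— the division-algebra injectivity being the THEOREM `eichlerShimura_weightTwo_rePeriod_injective_of_forall_isUnit` (§3). So a
consumer's cite stub may list exactly these two residues in place of (ESᶜ). [cite: ShimuraIATAF1971, Thm. 8.4 p. 234 and §9.2 p. 246] -/
theorem eichlerShimura_weightTwo_rePeriod_of_residue'
    (hinj : eichlerShimura_weightTwo_rePeriod_injective_of_exists_not_isUnit)
    (hsurj : eichlerShimura_weightTwo_rePeriod_surjective) : eichlerShimura_weightTwo_rePeriod :=
  eichlerShimura_weightTwo_rePeriod_of_residue eichlerShimura_weightTwo_rePeriod_injective_of_forall_isUnit hinj hsurj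

/-- (ESᶜ) ⟺ (ESᶜ-inj-split) ∧ (ESᶜ-surj): the print residue of (ESᶜ) is EXACTLY the injectivity at `B ≅ M₂(ℚ)` and the
surjectivity. [cite: ShimuraIATAF1971, Thm. 8.4 p. 234 and §9.2 p. 246] -/
theorem eichlerShimura_weightTwo_rePeriod_iff_residue :
    eichlerShimura_weightTwo_rePeriod ↔
      eichlerShimura_weightTwo_rePeriod_injective_of_exists_not_isUnit ∧ eichlerShimura_weightTwo_rePeriod_surjective :=
  ⟨fun h => ⟨h.injective_of_exists_not_isUnit, h.surjective⟩,
    fun h => eichlerShimura_weightTwo_rePeriod_of_residue' h.1 h.2⟩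

end Residue

end Literature.NumberTheory.Automorphic

end
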